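import Summits.KontsevichZagierPeriods.KontsevichZagierPeriods.Theorems.LinRedNormalFormArrangementNormalFormStubRebaseSimpleZeroNestedFinal

/-!
# Stub `stub_rebaseSimpleZeroTwo`, part `rebaseSimpleZero_nestedDifferent` (crux
`ArrangementNormalForm`, line `janus-bands`) — brick `NestedDiffExpand`

The rule-(1b) move that drives the rebase of a nested pair with letters of DIFFERENT
`y`-slopes over a one-dimensional base `y` (literal class `GS 0 2`): the **edge expansion**.
For a lettered fibre `tᵢ` with letter `cᵢ(y) = λᵢ y + γᵢ`, a target slope `μ` and a pivot
abscissa `r` put `Δ := μ − λᵢ` and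

  `R := (tᵢ − cᵢ(y)) − Δ (y − r) = tᵢ − (μ y + γᵢ − Δ r)`

(the wall `R = 0` is the letter line ROTATED to the slope `μ` about the abscissa `r`). Then
`1 = (tᵢ − cᵢ)/R − Δ (y − r)/R`, so the literal integrand `f` splits as `f = f₁ + f₂` with
`f₁ = f · (tᵢ − cᵢ)/R` — the SAME literal integrand with the letter of `tᵢ` replaced by the
rotated letter `RebaseDiff.rot cᵢ μ r` — and `f₂ = f · (−Δ (y − r)/R)`, which for `r = ℓ₂`
(the base pole) has no base pole any more. Both pieces converge absolutely as soon as the two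
factors are bounded on the domain, i.e. `|tᵢ − cᵢ| ≤ C |R|` (DOMINATED edge expansion,
`RebaseDiff.expand`; the automatic instance: `tᵢ − cᵢ` and `Δ (y − r)` of opposite signs,
`RebaseDiff.dominated_of_signs`). Generic glue: `RebaseDiff.split_of_integrable` (rule 1b with
given convergence). Registered: `rebaseSimpleZero_edgeExpand`.

References: M. Kontsevich, D. Zagier, *Periods* (2001), §1.2, rule (1b).
-/

noncomputable section

open Set MeasureTheory MvPolynomial
open Literature.NumberTheory.Transcendental Literature.ModelTheory.ExponentialFields

namespace Summit.KontsevichZagierPeriods.ArrangementNormalForm.JanusBands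

namespace RebaseDiff

open SeparatePos RebasePos RebaseZero RebaseNest

/-! ### Rule (1b) with given convergence -/

/-- **Rule (1b) with given convergence.** If the integrand of `r` is `g₁ + g₂` on the domain,
with `g₁, g₂` semialgebraic and absolutely integrable there, then `[r] − [r₁] − [r₂]` is a
relation for the two representations `rₗ = [r.domain, gₗ]`. [Kontsevich–Zagier 2001, §1.2,
rule (1b)] -/
theorem split_of_integrable {n : ℕ} (r : KZ.IntegralRep n) (g₁ g₂ : (Fin n → ℝ) → ℝ)
    (h₁ : IsSemialgebraicFunOn ℚ r.domain g₁) (h₂ : IsSemialgebraicFunOn ℚ r.domain g₂)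
    (hi₁ : IntegrableOn g₁ r.domain) (hi₂ : IntegrableOn g₂ r.domain)
    (hsum : EqOn r.integrand (g₁ + g₂) r.domain) :
    ∃ r₁ r₂ : KZ.IntegralRep n, r₁.domain = r.domain ∧ r₂.domain = r.domain ∧
      r₁.integrand = g₁ ∧ r₂.integrand = g₂ ∧ KZ.of r - KZ.of r₁ - KZ.of r₂ ∈ KZ.relations := by
  set r₁ : KZ.IntegralRep n := ⟨r.domain, g₁, r.isSemialgebraic_domain, h₁, hi₁⟩ with hr₁
  set r₂ : KZ.IntegralRep n := ⟨r.domain, g₂, r.isSemialgebraic_domain, h₂, hi₂⟩ with hr₂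
  exact ⟨r₁, r₂, rfl, rfl, rfl, rfl,
    KZ.integrandAddRel_subset_relations ⟨n, r, r₁, r₂, rfl, rfl, hsum, rfl⟩⟩

/-- **Domination.** The integrand of `r` times a semialgebraic factor bounded on the domain is
absolutely integrable on the domain (`SeparatePos.mulRep`). [folklore] -/
theorem integrableOn_mul_bdd {n : ℕ} (r : KZ.IntegralRep n) {g : (Fin n → ℝ) → ℝ}
    (hg : IsSemialgebraicFunOn ℚ r.domain g) (C : ℝ) (hC : ∀ x ∈ r.domain, |g x| ≤ C) :
    IntegrableOn (fun x => r.integrand x * g x) r.domain :=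
  (mulRep r g hg C hC).integrableOn

/-! ### The rotated letter and the wall -/

/-- The letter `c` ROTATED to the slope `μ` about the abscissa `r`: the line of slope `μ`
through the point `(r, c(r))`. -/
def rot (c : Cf) (μ r : ℚ) : Cf := mk μ (c.2 - (μ - c.1 (Fin.last 0)) * r)

/-- The slope of the rotated letter. -/
@[simp] theorem rot_fst (c : Cf) (μ r : ℚ) (l : Fin (0 + 1)) : (rot c μ r).1 l = μ := rfl

/-- **The wall identity** `t − rot(y) = (t − c(y)) − Δ (y − r)`, `Δ = μ − λ`. -/
theorem sub_ev_rot (c : Cf) (μ r : ℚ) (t y : ℝ) :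
    t - ev (rot c μ r) y = (t - ev c y) - ((μ - c.1 (Fin.last 0) : ℚ) : ℝ) * (y - r) := by
  rw [rot, ev_mk]
  simp only [ev, Rat.cast_sub, Rat.cast_mul]
  ring

/-- The rotated letter passes through the pivot `(r, c(r))`. -/
theorem ev_rot_self (c : Cf) (μ r : ℚ) : ev (rot c μ r) r = ev c r := by
  have := sub_ev_rot c μ r 0 r
  simp only [sub_self, mul_zero, sub_zero, zero_sub, neg_inj] at this
  exact this

variable {k : ℕ}

/-- The polynomial of the letter form `tᵢ − c(y)`. -/
def letterPoly (i : Fin k) (c : Cf) : MvPolynomial (Fin (0 + 1 + k)) ℚ :=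
  X (tIdx i) - (MvPolynomial.C (c.1 (Fin.last 0)) * X (yIdx k) + MvPolynomial.C c.2)

/-- `letterPoly` evaluates to `tᵢ − c(y)`. -/
@[simp] theorem aeval_letterPoly (i : Fin k) (c : Cf) (z : Fin (0 + 1 + k) → ℝ) :
    aeval z (letterPoly i c) = tv z i - ev c (yv z) := by
  simp [letterPoly, tv, yv, ev]

/-- The letter form `tᵢ − c(y)` is semialgebraic on every semialgebraic set. -/
theorem isSemialgebraicFunOn_letter {S : Set (Fin (0 + 1 + k) → ℝ)} (hS : IsSemialgebraic ℚ S)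
    (i : Fin k) (c : Cf) : IsSemialgebraicFunOn ℚ S (fun z => tv z i - ev c (yv z)) :=
  (isSemialgebraicFunOn_aeval hS (letterPoly i c)).congr fun z _ => aeval_letterPoly i c z

/-- The base form `y − r` is semialgebraic on every semialgebraic set. -/
theorem isSemialgebraicFunOn_base {S : Set (Fin (0 + 1 + k) → ℝ)} (hS : IsSemialgebraic ℚ S)
    (r : ℚ) : IsSemialgebraicFunOn ℚ S (fun z => yv z - (r : ℝ)) :=
  (isSemialgebraicFunOn_aeval hS (X (yIdx k) - MvPolynomial.C r)).congr fun z _ => by simp [yv]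

/-! ### The two factors of the edge expansion -/

/-- The factor `(tᵢ − cᵢ)/R` of the letter piece. -/
def facL (i : Fin k) (c : Cf) (μ r : ℚ) (z : Fin (0 + 1 + k) → ℝ) : ℝ :=
  (tv z i - ev c (yv z)) / (tv z i - ev (rot c μ r) (yv z))

/-- The factor `−Δ (y − r)/R` of the frame piece. -/
def facF (i : Fin k) (c : Cf) (μ r : ℚ) (z : Fin (0 + 1 + k) → ℝ) : ℝ :=
  -(((μ - c.1 (Fin.last 0) : ℚ) : ℝ) * (yv z - r)) / (tv z i - ev (rot c μ r) (yv z))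

/-- The two factors sum to `1` off the wall. -/
theorem facL_add_facF (i : Fin k) (c : Cf) (μ r : ℚ) (z : Fin (0 + 1 + k) → ℝ)
    (hR : tv z i - ev (rot c μ r) (yv z) ≠ 0) : facL i c μ r z + facF i c μ r z = 1 := by
  rw [facL, facF, ← add_div, div_eq_one_iff_eq hR, sub_ev_rot]
  ring

/-- `facL` is semialgebraic. -/
theorem isSemialgebraicFunOn_facL {S : Set (Fin (0 + 1 + k) → ℝ)} (hS : IsSemialgebraic ℚ S)
    (i : Fin k) (c : Cf) (μ r : ℚ) : IsSemialgebraicFunOn ℚ S (facL i c μ r) :=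
  IntegrateOut.isSemialgebraicFunOn_div (isSemialgebraicFunOn_letter hS i c)
    (isSemialgebraicFunOn_letter hS i (rot c μ r))

/-- `facF` is semialgebraic. -/
theorem isSemialgebraicFunOn_facF {S : Set (Fin (0 + 1 + k) → ℝ)} (hS : IsSemialgebraic ℚ S)
    (i : Fin k) (c : Cf) (μ r : ℚ) : IsSemialgebraicFunOn ℚ S (facF i c μ r) := by
  refine IntegrateOut.isSemialgebraicFunOn_div ?_ (isSemialgebraicFunOn_letter hS i (rot c μ r))
  exact (isSemialgebraicFunOn_aeval hS (-(MvPolynomial.C (μ - c.1 (Fin.last 0)) *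
    (X (yIdx k) - MvPolynomial.C r)))).congr fun z _ => by simp [yv]

/-- **Domination bounds.** If `|tᵢ − cᵢ| ≤ C |R|` on `S`, both factors are bounded on `S`. -/
theorem abs_fac_le {S : Set (Fin (0 + 1 + k) → ℝ)} (i : Fin k) (c : Cf) (μ r : ℚ) (C : ℝ)
    (hC : ∀ z ∈ S, |tv z i - ev c (yv z)| ≤ C * |tv z i - ev (rot c μ r) (yv z)|)
    (hne : ∀ z ∈ S, tv z i ≠ ev c (yv z)) (z : Fin (0 + 1 + k) → ℝ) (hz : z ∈ S) :
    |facL i c μ r z| ≤ C ∧ |facF i c μ r z| ≤ C + 1 := by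
  have hR : tv z i - ev (rot c μ r) (yv z) ≠ 0 := fun h => by
    have := hC z hz
    rw [h, abs_zero, mul_zero] at this
    exact hne z hz (sub_eq_zero.1 (abs_eq_zero.1 (le_antisymm this (abs_nonneg _))))
  have hRpos : 0 < |tv z i - ev (rot c μ r) (yv z)| := abs_pos.2 hR
  have h1 : |facL i c μ r z| ≤ C := by
    rw [facL, abs_div, div_le_iff₀ hRpos]
    exact hC z hz
  refine ⟨h1, ?_⟩
  have h2 : facF i c μ r z = 1 - facL i c μ r z := by
    rw [← facL_add_facF i c μ r z hR]; ring
  rw [h2]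
  calc |1 - facL i c μ r z| ≤ |(1 : ℝ)| + |facL i c μ r z| := abs_sub _ _
    _ ≤ C + 1 := by rw [abs_one]; linarith

/-- **Automatic domination by signs.** If `tᵢ − cᵢ` and `Δ (y − r)` have opposite (weak) signs
at `z` (`ε (tᵢ − cᵢ) ≥ 0 ≥ ε Δ (y − r)` for a sign `ε`), then `|tᵢ − cᵢ| ≤ |R|` at `z`. -/
theorem dominated_of_signs (i : Fin k) (c : Cf) (μ r : ℚ) (ε : ℝ) (hε : ε = 1 ∨ ε = -1)
    (z : Fin (0 + 1 + k) → ℝ) (hP : 0 ≤ ε * (tv z i - ev c (yv z)))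
    (hQ : ε * ((((μ - c.1 (Fin.last 0) : ℚ) : ℝ)) * (yv z - r)) ≤ 0) :
    |tv z i - ev c (yv z)| ≤ 1 * |tv z i - ev (rot c μ r) (yv z)| := by
  rw [one_mul, sub_ev_rot]
  rcases hε with rfl | rfl
  · rw [one_mul] at hP hQ
    rw [abs_of_nonneg hP, abs_of_nonneg (by linarith)]
    linarith
  · rw [abs_of_nonpos (by linarith), abs_of_nonpos (by linarith)]
    linarith

/-! ### Reading the letter piece literally -/

/-- Replacing the letter of the fibre `i` multiplies the literal integrand by
`(tᵢ − c)/(tᵢ − c')` wherever `tᵢ ≠ c`. -/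
theorem glitB_update_letter (T : BData) (p : MvPolynomial (Fin 0) ℚ) (a : Fin k → Option Cf)
    (i : Fin k) (c c' : Cf) (ha : a i = some c) (z : Fin (0 + 1 + k) → ℝ) (hz : tv z i ≠ ev c (yv z)) :
    glitB T p (Function.update a i (some c')) z =
      glitB T p a z * ((tv z i - ev c (yv z)) / (tv z i - ev c' (yv z))) := by
  have h1 := glit_split T p a i c ha z
  have h2 := glit_split T p (Function.update a i (some c')) i c' (Function.update_self ..) z
  rw [Function.update_idem] at h2
  rw [h2, h1, mul_assoc]
  congr 1
  field_simp [sub_ne_zero.2 hz]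

variable {m' : ℕ}

/-- **The edge expansion** (rule 1b, dominated). Let `s` carry a literal `GG 0 σ k` datum whose
fibre `i` has the letter `cᵢ`, and let `μ, r` be a target slope and a pivot abscissa such that
the letter does not vanish on the domain and `|tᵢ − cᵢ| ≤ C |R|` there,
`R = tᵢ − rot(cᵢ, μ, r)(y)`. Then `[s] − [s₁] − [s₂] ∈ KZ.relations` where `s₁` carries the
same literal datum with the letter of `tᵢ` replaced by the rotated letter (slope `μ`) and `s₂`
has the integrand `f · (−Δ (y − r)/R)` on the same domain. [Kontsevich–Zagier 2001, §1.2,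
rule (1b)] -/
theorem expand (s : KZ.IntegralRep (0 + 1 + k)) (M : Fin m' → Cf) (lo hi : Fin k → Fin k ⊕ Cf)
    (T : BData) (p : MvPolynomial (Fin 0) ℚ) (a : Fin k → Option Cf)
    (hbd : Bornology.IsBounded s.domain) (hdom : s.domain = gDom 0 k m' M lo hi)
    (hint : EqOn s.integrand (glitB T p a) s.domain) (i : Fin k) (c : Cf) (ha : a i = some c)
    (μ r : ℚ) (hne : ∀ z ∈ s.domain, tv z i ≠ ev c (yv z)) (C : ℝ)
    (hC : ∀ z ∈ s.domain, |tv z i - ev c (yv z)| ≤ C * |tv z i - ev (rot c μ r) (yv z)|) :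
    ∃ s₁ s₂ : KZ.IntegralRep (0 + 1 + k), s₁.domain = s.domain ∧ s₂.domain = s.domain ∧
      Bornology.IsBounded s₁.domain ∧ s₁.domain = gDom 0 k m' M lo hi ∧
      EqOn s₁.integrand (glitB T p (Function.update a i (some (rot c μ r)))) s₁.domain ∧
      (∀ z, s₂.integrand z = s.integrand z * facF i c μ r z) ∧
      KZ.of s - KZ.of s₁ - KZ.of s₂ ∈ KZ.relations := by
  have hsa := s.isSemialgebraic_domain
  have hb := abs_fac_le i c μ r C hC hne
  obtain ⟨s₁, s₂, hd₁, hd₂, hi₁, hi₂, hrel⟩ := split_of_integrable s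
    (fun z => s.integrand z * facL i c μ r z) (fun z => s.integrand z * facF i c μ r z)
    (IsSemialgebraicFunOn.mul_holds s.isSemialgebraicFunOn_integrand (isSemialgebraicFunOn_facL hsa i c μ r))
    (IsSemialgebraicFunOn.mul_holds s.isSemialgebraicFunOn_integrand (isSemialgebraicFunOn_facF hsa i c μ r))
    (integrableOn_mul_bdd s (isSemialgebraicFunOn_facL hsa i c μ r) C fun z hz => (hb z hz).1)
    (integrableOn_mul_bdd s (isSemialgebraicFunOn_facF hsa i c μ r) (C + 1) fun z hz => (hb z hz).2)
    (fun z hz => by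
      have hR : tv z i - ev (rot c μ r) (yv z) ≠ 0 := fun h => by
        have := hC z hz
        rw [h, abs_zero, mul_zero] at this
        exact hne z hz (sub_eq_zero.1 (abs_eq_zero.1 (le_antisymm this (abs_nonneg _))))
      show s.integrand z = s.integrand z * facL i c μ r z + s.integrand z * facF i c μ r z
      rw [← mul_add, facL_add_facF i c μ r z hR, mul_one])
  refine ⟨s₁, s₂, hd₁, hd₂, hd₁ ▸ hbd, hd₁.trans hdom, fun z hz => ?_, fun z => by rw [hi₂], hrel⟩
  rw [hd₁] at hz
  rw [hi₁]
  show s.integrand z * facL i c μ r z = _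
  rw [hint hz, glitB_update_letter T p a i c (rot c μ r) ha z (hne z hz), facL]

end RebaseDiff

/-- **Registered brick `rebaseSimpleZero_edgeExpand` of the part `rebaseSimpleZero_nestedDifferent`
(stub `stub_rebaseSimpleZeroTwo`, line `janus-bands`): the dominated edge expansion (rule 1b).**
For a literal `GG 0 σ k` datum whose fibre `i` carries the letter `c`, a target slope `μ` and a
pivot abscissa `r` with `|tᵢ − c(y)| ≤ C |tᵢ − rot(c, μ, r)(y)|` on the domain (the letter not
vanishing there), `[s] ≡ [s₁] + [s₂]` modulo `KZ.relations`, where `s₁` carries the same literal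
datum with the letter of `tᵢ` rotated to the slope `μ` about `r` and `s₂` carries the integrand
`f · (−(μ − λᵢ)(y − r))/(tᵢ − rot(c, μ, r)(y))` on the same domain (`RebaseDiff.expand`).
[Kontsevich–Zagier 2001, §1.2, rule (1b)] -/
theorem rebaseSimpleZero_edgeExpand (k m' : ℕ) (s : KZ.IntegralRep (0 + 1 + k)) (M : Fin m' → (Fin (0 + 1) → ℚ) × ℚ) (lo hi : Fin k → Fin k ⊕ ((Fin (0 + 1) → ℚ) × ℚ)) (T : RebaseZero.BData) (p : MvPolynomial (Fin 0) ℚ) (a : Fin k → Option ((Fin (0 + 1) → ℚ) × ℚ)) (hbd : Bornology.IsBounded s.domain) (hdom : s.domain = SeparatePos.gDom 0 k m' M lo hi) (hint : EqOn s.integrand (RebaseZero.glitB T p a) s.domain) (i : Fin k) (c : (Fin (0 + 1) → ℚ) × ℚ) (ha : a i = some c) (μ r : ℚ) (hne : ∀ z ∈ s.domain, RebaseZero.tv z i ≠ RebaseZero.ev c (RebaseZero.yv z)) (C : ℝ) (hC : ∀ z ∈ s.domain, |RebaseZero.tv z i - RebaseZero.ev c (RebaseZero.yv z)| ≤ C *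 |RebaseZero.tv z i - RebaseZero.ev (RebaseDiff.rot c μ r) (RebaseZero.yv z)|) : ∃ s₁ s₂ : KZ.IntegralRep (0 + 1 + k), s₁.domain = s.domain ∧ s₂.domain = s.domain ∧ Bornology.IsBounded s₁.domain ∧ s₁.domain = SeparatePos.gDom 0 k m' M lo hi ∧ EqOn s₁.integrand (RebaseZero.glitB T p (Function.update a i (some (RebaseDiff.rot c μ r)))) s₁.domain ∧ (∀ z, s₂.integrand z = s.integrand z * RebaseDiff.facF i c μ r z) ∧ KZ.of s - KZ.of s₁ - KZ.of s₂ ∈ KZ.relations :=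
  RebaseDiff.expand s M lo hi T p a hbd hdom hint i c ha μ r hne C hC

end Summit.KontsevichZagierPeriods.ArrangementNormalForm.JanusBands
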